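import Summits.QuantumFields.YangMills.Theorems.UnitScaleTiltProp7SectET3HDeltaHOfOpRowsHfT3
import Summits.QuantumFields.YangMills.Theorems.UnitScaleTiltProp7H46GradRowT3
import Summits.QuantumFields.YangMills.Theorems.UnitScaleTiltProp7QkOntoOfRegPr
import Summits.QuantumFields.YangMills.Theorems.UnitScaleTiltProp7SectET3SlotCurrentRowsT3
import Summits.QuantumFields.YangMills.Theorems.UnitScaleTiltProp7SectET3LandauRowsT3
import HarnessLib

/-!
# Route `UnitScaleTilt`, crux «MinimiserStabilityRegPr» (stmt-QuantumFields-19200, stub EX `stub_existenceMinimalOrbit`), route (α), node N06(d = 3) —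
# **«N1-COMPOSITE»: THE COMPOSITE LETTER `‖Δ̃π(H̃ᴾ X)‖₍₋₃₎ ≤ N₁·‖X‖` OF lit ✓`B11Eq98W80Composite.quadAnalytic_W80_composite` AT THE (W-X′) LETTERS OF RECORD, WITH
# `N₁ := c137π + k139π·B₀`, FROM THREE ROWS ALREADY ON THE EX DISPLAY (`h137π`, `hOp139′π`, `norm_Hπ`) — print's (88)** ([Balaban1985Variational] p. 291:
# «(Δ_π + DRD*)HD(A′) = Q*(QGQ*)⁻¹(…) − Q*aQHD(A′) … we can estimate this functional derivative by O(1)ε₁(Lʲη)⁻³»).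

Cell `ym3-torus` (HUMAN RULING D-0037, YM ladder rung R3 — YM₃ on T³ is a rung, NOT d = 4, NOT a mass gap, NOT Clay; YM gap NOT proved), width seat `ym3-torus-px19` (gen 4).
THEOREMS ONLY (0 `def`, 0 `sorry`); `--supports stmt-QuantumFields-19200 --as helper`; count-neutral; NO claim on crux ∕ stub ∕ registry.  Nothing of [Balaban1985Variational] ∕
[Balaban1985BackgroundPropagators] is asserted: an identity over landed Hilbert letters plus two triangle inequalities.

WHY (this seat's LOCATE «PROP4-W80 K-UNIFORMITY», 19200 evidence #57).  The `prop4` row of the EX display S13ᴰ (✓`Prop7StubEXOfChartPiecesTwS13D`) cannot descend through lit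
✓`B11Eq98CurrentSlot.quadAnalytic_W80_Jcur` with a member-uniform constant: its (97)-constant `C4W` is affine in the OPERATOR norm `‖Δ̃π‖_{(115)→(−3)}` of the slot current
`Δ̃π := currentCLM frobEquiv (fun _ ↦ K−n) (nabla115 η (bgOfCfg U₀)) (DeltaEtaSlot … c₀ U₀)`, which at the T³ member is `≥ c·L^{K−n}` (the (115)-norm controls one difference quotient,
`Δ^η` takes two).  Lit ✓`B11Eq98W80Composite.quadAnalytic_W80_composite` (NE9 lineage) avoids it through the COMPOSITE letter `hN₁ : ∀ X, ‖Δπ (H X)‖ ≤ N₁‖X‖`; THIS FILE supplies that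
letter at `(Δ̃π, H̃ᴾ) := (currentCLM …(DeltaEtaSlot …), H1f …(DeltaPiSlotP …))` from rows already displayed, so no new N06 row is created for it.

THE MECHANISM (def-free; every letter imported).  On the class `PosOnto …(DeltaPiSlotP) U₀` (= `hPosπ` + ✓`surjective_Qk_of_regPr`): with `B̃ := toL2B X` and the route reading
`X′ := ι(H̃ᴾ X) = toL2⁻¹ (HT B̃)` (✓`iota_H1f_eq`), (3.26) + `Q_kH = 1` + `R_SD*H = 0` give ✓`slot_sol_eq` at `x = 0`:
`Δ_πᴾ(toL2 X′) = Q_k†((QGQ*)⁻¹B̃) − Q_k†(a•B̃)` — (137)'s block letter —, hence bondwise `Δ^η(toL2 X′) = [Q_k†((QGQ*)⁻¹B̃) − Q_k†(a•B̃)] + (Δ^η − Δ_πᴾ)(toL2 X′)`; the first bracket is ROW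
`h137π` at `Y := X`, the second is ROW `hOp139′π` on the Landau field `X′` (✓`RS_DstarL2_HT`) with `s := B₀‖X‖` by ROW `norm_Hπ` (✓`norm_iota_H1f_apply_le`); the `(−3)`-size of the current
is the plain sup at the member (✓`norm_negSize_const_eq`) and its bond values ARE `toL2⁻¹(Δ^η(toL2 X′))` (✓`equiv_currentCLM_slot`).

WHAT IS PROVED (ns `…Theorems.Prop7DeltaEtaHfCompositeNorm`).
* §1 ★`DeltaPiSlotP_toL2_iota_H1f_eq` — the identity above; `norm_iota_H1f_le_of_normH` — `‖X′ bd‖ ≤ B₀‖X‖`; `landau_iota_H1f` — `R_SD*(toL2 X′) = 0`.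
* §2 ★★`norm_currentCLM_DeltaEtaSlot_H1f_le` — the member letter `∀ X, ‖Δ̃π(H̃ᴾ X)‖ ≤ (c137 + k139·B₀)·‖X‖` from `PosOnto`, `0 ≤ a`, and the three row BODIES.
* §3 ★★`hN₁_family_of_rows` — the family shape `∀ L>1 i U₀, RegPr (α L) U₀ → ∀ X, ‖Δ̃π(L,i,U₀)(H̃ᴾ(L,i,U₀) X)‖ ≤ (c137π L + k139π L·B₀ L)·‖X‖` from S13ᴰ's `hPosπ h137π hOp139π norm_Hπ`
  VERBATIM + `ha hWQ hk hB₀`.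
HONEST SCOPE: by-name composition over landed letters; the rows `h137π hOp139′π norm_Hπ hPosπ` stay DISPLAYED (N06); nothing of the stub ∕ crux claimed.
References: T. Bałaban, CMP 102 (1985) 277–309 [Balaban1985Variational] ((88) p.291, (137)–(139) pp.298–299, (45)–(46) p.285, (115) p.294, (27) p.282); CMP 99 (1985) 389–434
[Balaban1985BackgroundPropagators] ((3.26) p.395, (3.126) p.420, (3.12) p.392, Thm 3.11 p.416, (3.19) p.393).
-/

set_option autoImplicit false

noncomputable section

open scoped InnerProductSpace ComplexConjugate Matrix.Norms.L2Operator BigOperators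

namespace Summit.QuantumFields.YangMills.Theorems.Prop7DeltaEtaHfCompositeNorm

open Literature.MathematicalPhysics.QuantumFieldTheory.Balaban1983to89
open Literature.MathematicalPhysics.QuantumFieldTheory.Balaban1983to89.T3ContinuumYM3Torus
open Literature.MathematicalPhysics.QuantumFieldTheory.Balaban1983to89.T3Thm1Carrier (Idx)
open Literature.MathematicalPhysics.QuantumFieldTheory.Balaban1983to89.T3PrintedRegularMinimiser (RegPr)
open Literature.MathematicalPhysics.QuantumFieldTheory.Balaban1983to89.B9Eq3119DeltaPiCarrier (currentCLM)
open T3SectALandauChart (eta eta_pos)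
open B9SectCLatticeCarrier (Bond)
open B9Eq311L2Pairing (WL2)
open B11Eq103H1Complex (SiteL2K BondL2K)
open B11Eq115Space (NegSize Space115 JetSup NegSup levWeight)
open B11Eq111FrakG (nabla115)
open Summit.QuantumFields.YangMills.Theorems.Prop7SectET3Transport (periodsT3 bondEquiv bgOfCfg norm_negSize_const_eq)
open Summit.QuantumFields.YangMills.Theorems.Prop7SectET3HilbertLetters (W₂ frobEquiv toL2 toL2S toL2B DL2 DstarL2)
open Summit.QuantumFields.YangMills.Theorems.Prop7SectET3GaugeProjector (NS RS)
open Summit.QuantumFields.YangMills.Theorems.Prop7SectET3WilsonHessian (DeltaEta DeltaEtaSlot DeltaEtaSlot_apply)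
open Summit.QuantumFields.YangMills.Theorems.Prop7SectET3CurvedPropagators
open Summit.QuantumFields.YangMills.Theorems.Prop7SectET3DeltaPiPInv (DeltaPiSlotP H46P DeltaPiSlotP_kills_NS inner_DL2_DeltaPiP_eq_zero)
open Summit.QuantumFields.YangMills.Theorems.Prop7HessRowOfEq111 (slot_sol_eq)
open Summit.QuantumFields.YangMills.Theorems.Prop7SectET3DeltaPi (RS_DstarL2_HT)
open Summit.QuantumFields.YangMills.Theorems.Prop7QkOntoOfRegPr (surjective_Qk_of_regPr)
open Summit.QuantumFields.YangMills.Theorems.Prop7H46GradRow (norm_iota_H1f_apply_le)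
open Summit.QuantumFields.YangMills.Theorems.Prop7SectET3SlotCurrentRows (equiv_currentCLM_slot)

variable {F : T3Family} {n K : ℕ} {h : n ≤ K} {c₀ cB a : ℝ} [Fact (0 < c₀)] [Fact (0 < cB)]

/-! ## §1 The identity (88)∕(137) for the reader of record, its sup row and its Landau row -/

/-- ★ **(137)'S BLOCK LETTER IS `Δ_πᴾ` OF THE CHART's `H`**: on the class, for the route reading `X′ = ι(H̃ᴾ X) = toL2⁻¹(HT(toL2B X))` of the (115)-reader `H1f …(DeltaPiSlotP …) U₀`,
`Δ_πᴾ(U₀)(toL2 X′) = Q_k†((QGQ*)⁻¹ toL2B X) − Q_k†(a • toL2B X)` — (3.26) `Δ_a = Δ_πᴾ + DR_SD* + Q*aQ` with `Δ_aG = 1`, `R_SD*H = 0`, `Q_kH = 1` (✓`slot_sol_eq` at `x = 0`, guards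
✓`DeltaPiSlotP_kills_NS` ∕ ✓`inner_DL2_DeltaPiP_eq_zero`). [cite: Balaban1985Variational, (88) p.291, (137) p.298; Balaban1985BackgroundPropagators, (3.26) p.395, (3.126) p.420] -/
theorem DeltaPiSlotP_toL2_iota_H1f_eq [Fact (0 < (F.L : ℝ))] [Fact (0 < ((F.L : ℝ)⁻¹) ^ (K - n))] (ha : 0 ≤ a)
    {U₀ : GaugeField (F.P K) 0 (Matrix.specialUnitaryGroup (Fin 2) ℂ)} (hp : PosOnto F n K h c₀ cB a (DeltaPiSlotP F n K h c₀ cB a) U₀)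
    (X : PBond (F.P n) 0 → Matrix (Fin 2) (Fin 2) ℂ) :
    DeltaPiSlotP F n K h c₀ cB a U₀ (toL2 F K c₀ (fun b : PBond (F.P K) 0 => JetSup.equiv _ _ _ (H1f F n K h c₀ cB a (DeltaPiSlotP F n K h c₀ cB a) U₀ X) (bondEquiv F K b)))
      = LinearMap.adjoint (Qk F n K h c₀ cB U₀) (KinvT F n K h c₀ cB a (DeltaPiSlotP F n K h c₀ cB a) U₀ (toL2B F n cB X))
          - LinearMap.adjoint (Qk F n K h c₀ cB U₀) (((a : ℂ)) • toL2B F n cB X) := by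
  have h0 := slot_sol_eq hp (DeltaPiSlotP_kills_NS ha) (inner_DL2_DeltaPiP_eq_zero ha) 0 (toL2B F n cB X)
  simp only [map_zero, neg_zero, zero_add, add_zero] at h0
  rw [iota_H1f_eq, LinearEquiv.apply_symm_apply]
  exact h0

/-- **THE SUP ROW OF THE READING FROM `norm_Hπ`**: `‖X′ bd‖ ≤ B₀·‖X‖` for `X′ = ι(H̃ᴾ X)` whenever `‖H̃ᴾ X‖₍₁₁₅₎ ≤ B₀‖X‖` (on the diagonal the (115)-norm dominates every bond value,
✓`norm_iota_H1f_apply_le`). [cite: Balaban1985Variational, (115) p.294, (46) p.285; Balaban1985BackgroundPropagators, (3.133) p.422] -/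
theorem norm_iota_H1f_le_of_normH [Fact (0 < (F.L : ℝ))] [Fact (0 < ((F.L : ℝ)⁻¹) ^ (K - n))]
    {Δx : GaugeField (F.P K) 0 (Matrix.specialUnitaryGroup (Fin 2) ℂ) → (BondL2K ℂ 3 (periodsT3 F K) c₀ W₂ →ₗ[ℂ] BondL2K ℂ 3 (periodsT3 F K) c₀ W₂)}
    (U₀ : GaugeField (F.P K) 0 (Matrix.specialUnitaryGroup (Fin 2) ℂ)) {B₀ : ℝ}
    (hH : ∀ b : PBond (F.P n) 0 → Matrix (Fin 2) (Fin 2) ℂ, ‖H1f F n K h c₀ cB a Δx U₀ b‖ ≤ B₀ * ‖b‖)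
    (X : PBond (F.P n) 0 → Matrix (Fin 2) (Fin 2) ℂ) (bd : PBond (F.P K) 0) :
    ‖JetSup.equiv _ _ _ (H1f F n K h c₀ cB a Δx U₀ X) (bondEquiv F K bd)‖ ≤ B₀ * ‖X‖ :=
  (norm_iota_H1f_apply_le F n K h c₀ cB a Δx U₀ X (bondEquiv F K bd)).trans (hH X)

/-- **THE LANDAU ROW OF THE READING**: `R_S(D*_{U₀}(toL2 X′)) = 0` for `X′ = ι(H̃ᴾ X)` on the class ((45)₂ ✓`RS_DstarL2_HT` with the slot's orthogonality guard
✓`inner_DL2_DeltaPiP_eq_zero`). [cite: Balaban1985Variational, (45) p.285; Balaban1985BackgroundPropagators, (3.110) p.417, (3.126) p.420] -/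
theorem landau_iota_H1f [Fact (0 < (F.L : ℝ))] [Fact (0 < ((F.L : ℝ)⁻¹) ^ (K - n))] (ha : 0 ≤ a)
    {U₀ : GaugeField (F.P K) 0 (Matrix.specialUnitaryGroup (Fin 2) ℂ)} (hp : PosOnto F n K h c₀ cB a (DeltaPiSlotP F n K h c₀ cB a) U₀)
    (X : PBond (F.P n) 0 → Matrix (Fin 2) (Fin 2) ℂ) :
    RS F n K h c₀ cB U₀ (DstarL2 F n K c₀ U₀
      (toL2 F K c₀ (fun b : PBond (F.P K) 0 => JetSup.equiv _ _ _ (H1f F n K h c₀ cB a (DeltaPiSlotP F n K h c₀ cB a) U₀ X) (bondEquiv F K b)))) = 0 := by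
  rw [iota_H1f_eq, LinearEquiv.apply_symm_apply]
  exact RS_DstarL2_HT hp (inner_DL2_DeltaPiP_eq_zero ha) _

/-! ## §2 The composite letter `N₁` at the member -/

/-- ★★ **THE COMPOSITE LETTER `hN₁` OF lit ✓`quadAnalytic_W80_composite` AT THE (W-X′) LETTERS, MEMBER FORM: `‖Δ̃π(H̃ᴾ X)‖₍₋₃₎ ≤ (c137 + k139·B₀)·‖X‖`** for every block datum `X`, where
`Δ̃π = currentCLM frobEquiv (fun _ ↦ K−n) (nabla115 η (bgOfCfg U₀)) (DeltaEtaSlot … c₀ U₀)` (the Wilson Hessian `Δ^η` read as a current) and `H̃ᴾ = H1f …(DeltaPiSlotP …) U₀` (the (115)-reader of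
print's `H = GQ*(QGQ*)⁻¹` at `Δ_πᴾ`), on the class `PosOnto …(DeltaPiSlotP) U₀`, `0 ≤ a`, from the BODIES of the display rows `norm_Hπ` (`hH`), `h137π` (`h137`), `hOp139′π` (`hOp139`) at this
member: `Δ^η H = [Q_k†(QGQ*)⁻¹ − Q_k†a] + (Δ^η − Δ_πᴾ)H` (§1), the (−3)-size is the plain sup at the member (✓`norm_negSize_const_eq`), the bond values of the current are
`toL2⁻¹(Δ^η(toL2 X′))` (✓`equiv_currentCLM_slot`).  Print's (88). [cite: Balaban1985Variational, (88) p.291, (137)–(139) pp.298–299, (27) p.282, (115) p.294; Balaban1985BackgroundPropagators, (3.26) p.395, (3.12) p.392] -/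
theorem norm_currentCLM_DeltaEtaSlot_H1f_le [Fact (0 < (F.L : ℝ))] [Fact (0 < ((F.L : ℝ)⁻¹) ^ (K - n))] (ha : 0 ≤ a)
    {U₀ : GaugeField (F.P K) 0 (Matrix.specialUnitaryGroup (Fin 2) ℂ)} (hp : PosOnto F n K h c₀ cB a (DeltaPiSlotP F n K h c₀ cB a) U₀)
    {B₀ c137 k139 : ℝ} (hB₀ : 0 ≤ B₀) (hc137 : 0 ≤ c137) (hk139 : 0 ≤ k139)
    (hH : ∀ b : PBond (F.P n) 0 → Matrix (Fin 2) (Fin 2) ℂ, ‖H1f F n K h c₀ cB a (DeltaPiSlotP F n K h c₀ cB a) U₀ b‖ ≤ B₀ * ‖b‖)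
    (h137 : ∀ (Y : PBond (F.P n) 0 → Matrix (Fin 2) (Fin 2) ℂ) (b : PBond (F.P K) 0),
      ‖(toL2 F K c₀).symm (LinearMap.adjoint (Qk F n K h c₀ cB U₀) (KinvT F n K h c₀ cB a (DeltaPiSlotP F n K h c₀ cB a) U₀ (toL2B F n cB Y))
          - LinearMap.adjoint (Qk F n K h c₀ cB U₀) (((a : ℂ)) • toL2B F n cB Y)) b‖ ≤ c137 * ‖Y‖)
    (hOp139 : ∀ (X : PBond (F.P K) 0 → Matrix (Fin 2) (Fin 2) ℂ) (s : ℝ), RS F n K h c₀ cB U₀ (DstarL2 F n K c₀ U₀ (toL2 F K c₀ X)) = 0 → (∀ bd, ‖X bd‖ ≤ s) →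
      ∀ bd : PBond (F.P K) 0, ‖(toL2 F K c₀).symm (DeltaEta F n K c₀ U₀ (toL2 F K c₀ X) - DeltaPiSlotP F n K h c₀ cB a U₀ (toL2 F K c₀ X)) bd‖ ≤ k139 * s)
    (X : PBond (F.P n) 0 → Matrix (Fin 2) (Fin 2) ℂ) :
    ‖currentCLM frobEquiv (fun _ : Bond 3 (periodsT3 F K) × Fin 3 => K - n) (nabla115 (((F.L : ℝ)⁻¹) ^ (K - n)) (bgOfCfg F K U₀)) (DeltaEtaSlot F n K c₀ U₀)
        (H1f F n K h c₀ cB a (DeltaPiSlotP F n K h c₀ cB a) U₀ X)‖ ≤ (c137 + k139 * B₀) * ‖X‖ := by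
  -- the route reading `X′ = ι(H̃ᴾ X)` of the (115)-field, its sup row and its Landau row
  set X' : PBond (F.P K) 0 → Matrix (Fin 2) (Fin 2) ℂ :=
    fun b : PBond (F.P K) 0 => JetSup.equiv _ _ _ (H1f F n K h c₀ cB a (DeltaPiSlotP F n K h c₀ cB a) U₀ X) (bondEquiv F K b) with hX'
  have hs : ∀ bd, ‖X' bd‖ ≤ B₀ * ‖X‖ := fun bd => norm_iota_H1f_le_of_normH U₀ hH X bd
  have hland : RS F n K h c₀ cB U₀ (DstarL2 F n K c₀ U₀ (toL2 F K c₀ X')) = 0 := landau_iota_H1f ha hp X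
  -- the decomposition `Δ^η(toL2 X′) = [Q_k†(QGQ*)⁻¹B̃ − Q_k†(a•B̃)] + (Δ^η − Δ_πᴾ)(toL2 X′)`
  have hsplit : DeltaEta F n K c₀ U₀ (toL2 F K c₀ X')
      = (LinearMap.adjoint (Qk F n K h c₀ cB U₀) (KinvT F n K h c₀ cB a (DeltaPiSlotP F n K h c₀ cB a) U₀ (toL2B F n cB X))
          - LinearMap.adjoint (Qk F n K h c₀ cB U₀) (((a : ℂ)) • toL2B F n cB X))
        + (DeltaEta F n K c₀ U₀ (toL2 F K c₀ X') - DeltaPiSlotP F n K h c₀ cB a U₀ (toL2 F K c₀ X')) := by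
    rw [← DeltaPiSlotP_toL2_iota_H1f_eq ha hp X, add_sub_cancel]
  -- the (−3)-size at the member is the plain sup of the bond values
  have hr : 0 ≤ (c137 + k139 * B₀) * ‖X‖ := by positivity
  rw [norm_negSize_const_eq (K - n) 3, pi_norm_le_iff_of_nonneg hr]
  intro b
  rw [equiv_currentCLM_slot, DeltaEtaSlot_apply, hsplit, map_add, Pi.add_apply]
  refine (norm_add_le _ _).trans ?_
  have h1 := h137 X ((bondEquiv F K).symm b)
  have h2 := hOp139 X' (B₀ * ‖X‖) hland hs ((bondEquiv F K).symm b)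
  calc _ ≤ c137 * ‖X‖ + k139 * (B₀ * ‖X‖) := add_le_add h1 h2
    _ = (c137 + k139 * B₀) * ‖X‖ := by ring

/-! ## §3 The family shape over the EX display's rows -/

variable [hFL : ∀ F : T3Family, Fact (0 < (F.L : ℝ))] [hFη : ∀ (F : T3Family) (k : ℕ), Fact (0 < ((F.L : ℝ)⁻¹) ^ k)]

/-- ★★ **THE COMPOSITE LETTER `hN₁` AT THE FAMILY LEVEL, FROM S13ᴰ's ROWS VERBATIM** (✓`Prop7StubEXOfChartPiecesTwS13D`): `hPosπ` ([B9] Thm 3.11 positivity for `G` at Δ_πᴾ; onto-half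
✓`surjective_Qk_of_regPr` under `hWQ`), `norm_Hπ` ((3.133) for print's `H`), `h137π` ((137)'s block letter at Δ_πᴾ), `hOp139π` (the slot-defect row on Landau fields), `ha` (`0 < a`), `hB₀`, `hk`-class
nonnegativity of `c137π k139π` ⟹ for every member `(L, i, U₀)` with `RegPr (α L) U₀` and every block datum `X`,
`‖currentCLM …(DeltaEtaSlot …(c₀ L) U₀) (H1f …(DeltaPiSlotP …) U₀ X)‖ ≤ (c137π L + k139π L·B₀ L)·‖X‖` — the `hN₁` binder of lit ✓`quadAnalytic_W80_composite` at the (W-X′) letters with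
`N₁ L := c137π L + k139π L·B₀ L`, K-uniform by the display's own letters. [cite: Balaban1985Variational, (88) p.291, (137)–(139) pp.298–299; Balaban1985BackgroundPropagators, Thm 3.11 p.416, (3.19) p.393, (3.26) p.395, (3.133) p.422] -/
theorem hN₁_family_of_rows {α : ℕ → ℝ} {c₀ cB : ℕ → ℝ} [hc₀ : ∀ L : ℕ, Fact (0 < c₀ L)] [hcB : ∀ L : ℕ, Fact (0 < cB L)] {a : ∀ L : ℕ, Idx L → ℝ}
    {B₀ c137π k139π : ℕ → ℝ}
    (ha : ∀ (L : ℕ) (i : Idx L), 0 < a L i) (hB₀ : ∀ L, 1 < L → 0 < B₀ L)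
    (hkπ : ∀ L : ℕ, 1 < L → 0 ≤ c137π L ∧ 0 ≤ k139π L)
    (hWQ : ∀ L : ℕ, 1 < L → 13 * 10 ^ 14 * (L : ℝ) ^ 3 * α L ≤ 1)
    (hPosπ : ∀ (L : ℕ), 1 < L → ∀ (i : Idx L) (U₀ : GaugeField (i.1.1.P i.1.2.2) 0 (Matrix.specialUnitaryGroup (Fin 2) ℂ)), RegPr i.1.1 i.1.2.1 i.1.2.2 (α L) U₀ →
      ∀ x : BondL2K ℂ 3 (periodsT3 i.1.1 i.1.2.2) (c₀ L) W₂, x ≠ 0 →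
        0 < RCLike.re ⟪x, laplaceA i.1.1 i.1.2.1 i.1.2.2 i.2.2.le (c₀ L) (cB L) (a L i) (DeltaPiSlotP i.1.1 i.1.2.1 i.1.2.2 i.2.2.le (c₀ L) (cB L) (a L i)) U₀ x⟫_ℂ)
    (norm_Hπ : ∀ (L : ℕ), 1 < L → ∀ (i : Idx L) (ρ : ℝ) (U₀ : GaugeField (i.1.1.P i.1.2.2) 0 (Matrix.specialUnitaryGroup (Fin 2) ℂ)),
      RegPr i.1.1 i.1.2.1 i.1.2.2 ρ U₀ → ρ ≤ α L → ∀ b, ‖H1f i.1.1 i.1.2.1 i.1.2.2 i.2.2.le (c₀ L) (cB L) (a L i) (DeltaPiSlotP i.1.1 i.1.2.1 i.1.2.2 i.2.2.le (c₀ L) (cB L) (a L i)) U₀ b‖ ≤ B₀ L * ‖b‖)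
    (h137π : ∀ (L : ℕ), 1 < L → ∀ (i : Idx L) (U₀ : GaugeField (i.1.1.P i.1.2.2) 0 (Matrix.specialUnitaryGroup (Fin 2) ℂ)), RegPr i.1.1 i.1.2.1 i.1.2.2 (α L) U₀ →
      ∀ (Y : PBond (i.1.1.P i.1.2.1) 0 → Matrix (Fin 2) (Fin 2) ℂ) (b : PBond (i.1.1.P i.1.2.2) 0),
        ‖(toL2 i.1.1 i.1.2.2 (c₀ L)).symm (LinearMap.adjoint (Qk i.1.1 i.1.2.1 i.1.2.2 i.2.2.le (c₀ L) (cB L) U₀) (KinvT i.1.1 i.1.2.1 i.1.2.2 i.2.2.le (c₀ L) (cB L) (a L i) (DeltaPiSlotP i.1.1 i.1.2.1 i.1.2.2 i.2.2.le (c₀ L) (cB L) (a L i)) U₀ (toL2B i.1.1 i.1.2.1 (cB L) Y))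
            - LinearMap.adjoint (Qk i.1.1 i.1.2.1 i.1.2.2 i.2.2.le (c₀ L) (cB L) U₀) (((a L i : ℂ)) • toL2B i.1.1 i.1.2.1 (cB L) Y)) b‖ ≤ c137π L * ‖Y‖)
    (hOp139π : ∀ (L : ℕ), 1 < L → ∀ (i : Idx L) (U₀ : GaugeField (i.1.1.P i.1.2.2) 0 (Matrix.specialUnitaryGroup (Fin 2) ℂ)), RegPr i.1.1 i.1.2.1 i.1.2.2 (α L) U₀ →
      ∀ (X : PBond (i.1.1.P i.1.2.2) 0 → Matrix (Fin 2) (Fin 2) ℂ) (s : ℝ), RS i.1.1 i.1.2.1 i.1.2.2 i.2.2.le (c₀ L) (cB L) U₀ (DstarL2 i.1.1 i.1.2.1 i.1.2.2 (c₀ L) U₀ (toL2 i.1.1 i.1.2.2 (c₀ L) X)) = 0 → (∀ bd, ‖X bd‖ ≤ s) →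
        ∀ bd : PBond (i.1.1.P i.1.2.2) 0, ‖(toL2 i.1.1 i.1.2.2 (c₀ L)).symm (DeltaEta i.1.1 i.1.2.1 i.1.2.2 (c₀ L) U₀ (toL2 i.1.1 i.1.2.2 (c₀ L) X) - (DeltaPiSlotP i.1.1 i.1.2.1 i.1.2.2 i.2.2.le (c₀ L) (cB L) (a L i)) U₀ (toL2 i.1.1 i.1.2.2 (c₀ L) X)) bd‖ ≤ k139π L * s) :
    ∀ (L : ℕ), 1 < L → ∀ (i : Idx L) (U₀ : GaugeField (i.1.1.P i.1.2.2) 0 (Matrix.specialUnitaryGroup (Fin 2) ℂ)), RegPr i.1.1 i.1.2.1 i.1.2.2 (α L) U₀ →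
      ∀ X : PBond (i.1.1.P i.1.2.1) 0 → Matrix (Fin 2) (Fin 2) ℂ,
        ‖currentCLM frobEquiv (fun _ : Bond 3 (periodsT3 i.1.1 i.1.2.2) × Fin 3 => i.1.2.2 - i.1.2.1) (nabla115 (((i.1.1.L : ℝ)⁻¹) ^ (i.1.2.2 - i.1.2.1)) (bgOfCfg i.1.1 i.1.2.2 U₀))
            (DeltaEtaSlot i.1.1 i.1.2.1 i.1.2.2 (c₀ L) U₀)
            (H1f i.1.1 i.1.2.1 i.1.2.2 i.2.2.le (c₀ L) (cB L) (a L i) (DeltaPiSlotP i.1.1 i.1.2.1 i.1.2.2 i.2.2.le (c₀ L) (cB L) (a L i)) U₀ X)‖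
          ≤ (c137π L + k139π L * B₀ L) * ‖X‖ := by
  intro L hL i U₀ hU X
  have hWQ' : 13 * 10 ^ 14 * (i.1.1.L : ℝ) ^ 3 * α L ≤ 1 := by rw [i.2.1]; exact hWQ L hL
  have hp : PosOnto i.1.1 i.1.2.1 i.1.2.2 i.2.2.le (c₀ L) (cB L) (a L i) (DeltaPiSlotP i.1.1 i.1.2.1 i.1.2.2 i.2.2.le (c₀ L) (cB L) (a L i)) U₀ :=
    ⟨hPosπ L hL i U₀ hU, surjective_Qk_of_regPr i.1.1 i.2.2.le i.2.2 (c₀ L) (cB L) hU hWQ'⟩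
  exact norm_currentCLM_DeltaEtaSlot_H1f_le (ha L i).le hp (hB₀ L hL).le (hkπ L hL).1 (hkπ L hL).2
    (fun b => norm_Hπ L hL i (α L) U₀ hU le_rfl b) (h137π L hL i U₀ hU) (hOp139π L hL i U₀ hU) X

end Summit.QuantumFields.YangMills.Theorems.Prop7DeltaEtaHfCompositeNorm

end
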